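import Mathlib
import Literature.Geometry.Symplectic.JHolomorphicMap
import Literature.Topology.ProperLocalHomeomorph
import Summits.SmoothPoincare4.SmoothPoincare4.Theorems.SullivanDualTameOrBrodyR4PencilDefs
import Summits.SmoothPoincare4.SmoothPoincare4.Theorems.SullivanDualTameOrBrodyR4ContinuityEstimates
import Summits.SmoothPoincare4.SmoothPoincare4.Theorems.SullivanDualTameOrBrodyR4ContinuityClosedness
import Summits.SmoothPoincare4.SmoothPoincare4.Theorems.SullivanDualTameOrBrodyR4ContinuityMethod
import Summits.SmoothPoincare4.SmoothPoincare4.Theorems.SullivanDualTameOrBrodyR4StubConfineQ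

/-!
# The continuity method from uniqueness of members (crux `TameOrBrodyR4`, stmt-SmoothPoincare4-7826, line `Sketch`, skeleton v15 — registered helper `helper_continuityOfUniqueness`)

The continuity method for Gromov's anchored pencil of `J`-planes on `ℝ⁴` (vocabulary
`Theorems/SullivanDualTameOrBrodyR4PencilDefs.lean`), with the deep input
`HasUniqueDisjointMembers` (uniqueness AND disjointness of members) WEAKENED to uniqueness alone:
two normalised members with the same asymptotic value coincide.  Conclusion as in
`Continuity.continuity_method` (`…ContinuityMethod.lean`): EITHER the complete pencil exists as a
jointly `C^∞`, bijective evaluation map `F : ℂ → ℂ → ℝ⁴` with bijective differential, `F b` the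
member with value `b`, honest far out — OR blow-up data.

Proof.  Everything up to the bijectivity of the differential of `Fu (b, ξ) = F b ξ` is the proof
of `Continuity.continuity_method` verbatim (clopen argument for the moduli set from
`helper_memberFlat`, `helper_closedOrBlowup`, `HasLocalFamilies`; joint smoothness and injective,
hence bijective, differential from the local families and uniqueness).  Disjointness of members was
used there only for the injectivity of `Fu`; here it is replaced by the soft covering-space
argument `Literature.Topology.IsLocalHomeomorph.bijective_of_existsUnique`: `Fu` is a local
homeomorphism (inverse function theorem), PROPER (a point `(b, ξ)` with `Fu (b, ξ)` in a compact
set is bounded: honesty of far members and the uniform normalisation `helper_memberEstimates`),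
and has ONE GOOD FIBRE — over the far point `x₀ = Fu (3R, 0)` (`Q x₀ = 3R`): a member through
`x₀` with value `|b| < 2R` would violate the `Q`-confinement `stub_confineQ` (maximum principle),
and the far members are the flat planes.  Hence `Fu` is bijective.

References: M. Gromov, Invent. Math. 82 (1985), §2.4.A; D. McDuff, JAMS 3 (1990), §3;
O. Forster, *Lectures on Riemann Surfaces* (1981), §4.21–4.24 (proper unbranched coverings).
-/

-- the registered namespace `Summit.SmoothPoincare4.SmoothPoincare4.…` repeats a component
set_option linter.dupNamespace false

noncomputable section

open scoped ContDiff Topology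
open Filter Set Metric Literature.Geometry.Symplectic

namespace Summit.SmoothPoincare4.SmoothPoincare4.Cruxes.TameOrBrodyR4.Sketch

/-- Local notation for the model space `ℝ⁴ = EuclideanSpace ℝ (Fin 4)`. -/
local notation "E4" => EuclideanSpace ℝ (Fin 4)

/-- (C2) the continuity method from local families + UNIQUENESS of members + embedded limits:
disjointness of members is not assumed (the evaluation map is a proper local diffeomorphism with
one good fibre, hence bijective — `Literature.Topology.IsLocalHomeomorph.bijective_of_existsUnique`). -/
theorem helper_continuityOfUniqueness (J : E4 → E4 →L[ℝ] E4) (R : ℝ) (P Q : E4 →L[ℝ] ℂ)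
    (eP eQ : ℂ →L[ℝ] E4)
    (hR : 0 < R) (hJs : ContDiff ℝ ∞ J) (hJ2 : ∀ x v, J x (J x v) = -v)
    (hPQ : IsCoordFrame P Q eP eQ)
    (hJP : ∀ x : E4, R ≤ ‖x‖ → ∀ v, P (J x v) = Complex.I * P v)
    (hJQ : ∀ x : E4, R ≤ ‖x‖ → ∀ v, Q (J x v) = Complex.I * Q v)
    (hLF : HasLocalFamilies J R P Q)
    (hU : ∀ (b : ℂ) (u u' : ℂ → E4), IsPencilMember J R P Q b u → IsPencilMember J R P Q b u' →
      u = u')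
    (hEL : HasEmbeddedLimits J R P Q) :
    (∃ F : ℂ → ℂ → E4,
      ContDiff ℝ ∞ (fun p : ℂ × ℂ => F p.1 p.2) ∧
      Function.Bijective (fun p : ℂ × ℂ => F p.1 p.2) ∧
      (∀ p : ℂ × ℂ, Function.Bijective (fderiv ℝ (fun p : ℂ × ℂ => F p.1 p.2) p)) ∧
      (∀ b, IsPencilMember J R P Q b (F b)) ∧
      (∀ b : ℂ, 3 * R ≤ ‖b‖ → ∀ ξ, Q (F b ξ) = b) ∧
      (∀ x : E4, 3 * R ≤ ‖Q x‖ → ∃ ξ, F (Q x) ξ = x)) ∨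
    (∃ (K : Set E4) (f : ℕ → ℂ → E4), IsCompact K ∧ (∀ n, ContDiff ℝ ∞ (f n)) ∧
      (∀ n, IsJHolomorphicFlat J (f n)) ∧ (∀ n (z : ℂ), ‖z‖ ≤ 1 → f n z ∈ K) ∧
      Tendsto (fun n => ‖fderiv ℝ (f n) 0‖) atTop atTop) := by
  classical
  by_cases hblow : ∃ (K : Set E4) (f : ℕ → ℂ → E4), IsCompact K ∧ (∀ n, ContDiff ℝ ∞ (f n)) ∧
      (∀ n, IsJHolomorphicFlat J (f n)) ∧ (∀ n (z : ℂ), ‖z‖ ≤ 1 → f n z ∈ K) ∧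
      Tendsto (fun n => ‖fderiv ℝ (f n) 0‖) atTop atTop
  · exact Or.inr hblow
  left
  obtain ⟨-, hPeP, hQeP, hPeQ, hQeQ, hsum⟩ := id hPQ
  -- the moduli set of realised asymptotic values
  set U : Set ℂ := {b | ∃ u, IsPencilMember J R P Q b u}
  have hflat : ∀ b : ℂ, 2 * R ≤ ‖b‖ → IsPencilMember J R P Q b (fun ξ => eP ξ + eQ b) :=
    helper_memberFlat J R P Q eP eQ hR hPQ hJP hJQ
  have hfar : ∀ b : ℂ, 2 * R ≤ ‖b‖ → b ∈ U := fun b hb => ⟨_, hflat b hb⟩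
  -- closed (closedness modulo blow-up, blow-up being excluded)
  have hclosed : IsClosed U := by
    refine IsSeqClosed.isClosed fun b bs hbU hbs => ?_
    by_cases hbs2 : 2 * R ≤ ‖bs‖
    · exact hfar bs hbs2
    push Not at hbs2
    have hev : ∀ᶠ n in atTop, ‖b n‖ < 2 * R := hbs.norm.eventually (gt_mem_nhds hbs2)
    obtain ⟨N, hN⟩ := eventually_atTop.mp hev
    choose u hu using hbU
    rcases helper_closedOrBlowup J R P Q eP eQ hR hJs hJ2 hPQ hJP hJQ hEL (fun n => b (n + N))
        (fun n => u (n + N)) bs (fun n => hu _) (fun n => hN _ (Nat.le_add_left N n))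
        ((tendsto_add_atTop_iff_nat N).mpr hbs) with ⟨v, hv⟩ | hbl
    · exact ⟨v, hv⟩
    · exact absurd hbl hblow
  -- open (local families)
  have hopen : IsOpen U := by
    rw [Metric.isOpen_iff]
    rintro b₀ ⟨u₀, hu₀⟩
    obtain ⟨ε, hε, Φ, -, -, hΦm, -⟩ := hLF b₀ u₀ hu₀
    exact ⟨ε, hε, fun b hb => ⟨Φ b, hΦm b hb⟩⟩
  -- hence everything
  have h2Rmem : ((2 * R : ℝ) : ℂ) ∈ U :=
    hfar _ (by rw [Complex.norm_real, Real.norm_of_nonneg (by positivity)])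
  have hUu : U = univ := IsClopen.eq_univ ⟨hclosed, hopen⟩ ⟨_, h2Rmem⟩
  have hall : ∀ b : ℂ, ∃ u, IsPencilMember J R P Q b u := fun b => by
    have hb : b ∈ U := by rw [hUu]; exact mem_univ b
    exact hb
  choose F hF using hall
  have huniq : ∀ b u, IsPencilMember J R P Q b u → u = F b := fun b u hu => hU b u (F b) hu (hF b)
  have hflatF : ∀ b : ℂ, 2 * R ≤ ‖b‖ → F b = fun ξ => eP ξ + eQ b := fun b hb =>
    (huniq b _ (hflat b hb)).symm
  -- local agreement with the smooth local families
  have hlocal : ∀ b₀ : ℂ, ∃ ε > 0, ∃ Φ : ℂ → ℂ → E4,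
      ContDiffOn ℝ ∞ (fun p : ℂ × ℂ => Φ p.1 p.2) (ball b₀ ε ×ˢ univ) ∧
      (∀ b ∈ ball b₀ ε, Φ b = F b) ∧
      (∀ b ∈ ball b₀ ε, ∀ ξ β ζ : ℂ,
        fderiv ℝ (fun b' => Φ b' ξ) b β = fderiv ℝ (Φ b) ξ ζ → β = 0) := fun b₀ => by
    obtain ⟨ε, hε, Φ, hΦs, -, hΦm, hΦt⟩ := hLF b₀ (F b₀) (hF b₀)
    exact ⟨ε, hε, Φ, hΦs, fun b hb => huniq b _ (hΦm b hb), hΦt⟩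
  set Fu : ℂ × ℂ → E4 := fun p => F p.1 p.2
  -- (F1) joint smoothness
  have hF1 : ContDiff ℝ ∞ Fu := by
    rw [contDiff_iff_contDiffAt]
    rintro ⟨b₀, ξ₀⟩
    obtain ⟨ε, hε, Φ, hΦs, hΦF, -⟩ := hlocal b₀
    have hnhds : ball b₀ ε ×ˢ (univ : Set ℂ) ∈ 𝓝 (b₀, ξ₀) :=
      prod_mem_nhds (ball_mem_nhds b₀ hε) univ_mem
    have h1 : ContDiffAt ℝ ∞ (fun p : ℂ × ℂ => Φ p.1 p.2) (b₀, ξ₀) :=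
      hΦs.contDiffAt hnhds
    refine h1.congr_of_eventuallyEq ?_
    filter_upwards [hnhds] with p hp
    show F p.1 p.2 = Φ p.1 p.2
    rw [hΦF p.1 hp.1]
  have hdiff : ∀ p, DifferentiableAt ℝ Fu p := fun p => hF1.contDiffAt.differentiableAt (by simp)
  -- partial derivatives of the uncurried map
  have hpb : ∀ (b₀ ξ₀ β : ℂ), fderiv ℝ Fu (b₀, ξ₀) (β, 0) = fderiv ℝ (fun b' => F b' ξ₀) b₀ β := by
    intro b₀ ξ₀ β
    have hc : HasFDerivAt (fun b' : ℂ => (b', ξ₀)) (ContinuousLinearMap.inl ℝ ℂ ℂ) b₀ :=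
      hasFDerivAt_prodMk_left b₀ ξ₀
    have hcomp := (hdiff (b₀, ξ₀)).hasFDerivAt.comp b₀ hc
    rw [show (fun b' => F b' ξ₀) = Fu ∘ fun b' => (b', ξ₀) from rfl, hcomp.fderiv]
    rfl
  have hpξ : ∀ (b₀ ξ₀ ζ : ℂ), fderiv ℝ Fu (b₀, ξ₀) (0, ζ) = fderiv ℝ (F b₀) ξ₀ ζ := by
    intro b₀ ξ₀ ζ
    have hc : HasFDerivAt (fun ξ : ℂ => (b₀, ξ)) (ContinuousLinearMap.inr ℝ ℂ ℂ) ξ₀ :=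
      hasFDerivAt_prodMk_right b₀ ξ₀
    have hcomp := (hdiff (b₀, ξ₀)).hasFDerivAt.comp ξ₀ hc
    rw [show F b₀ = Fu ∘ fun ξ => (b₀, ξ) from rfl, hcomp.fderiv]
    rfl
  -- (F3) bijective differential
  have hF3 : ∀ p : ℂ × ℂ, Function.Bijective (fderiv ℝ Fu p) := by
    rintro ⟨b₀, ξ₀⟩
    obtain ⟨ε, hε, Φ, -, hΦF, hΦt⟩ := hlocal b₀
    have hΦb : fderiv ℝ (fun b' => Φ b' ξ₀) b₀ = fderiv ℝ (fun b' => F b' ξ₀) b₀ :=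
      Filter.EventuallyEq.fderiv_eq (by
        filter_upwards [ball_mem_nhds b₀ hε] with b' hb'
        rw [hΦF b' hb'])
    have hinj : Function.Injective (fderiv ℝ Fu (b₀, ξ₀)) := by
      rw [injective_iff_map_eq_zero]
      rintro ⟨β, ζ⟩ h0
      have hsplit : fderiv ℝ Fu (b₀, ξ₀) (β, ζ) =
          fderiv ℝ (fun b' => F b' ξ₀) b₀ β + fderiv ℝ (F b₀) ξ₀ ζ := by
        rw [← hpb, ← hpξ, ← map_add, Prod.mk_add_mk, add_zero, zero_add]
      rw [hsplit] at h0
      have hβ : β = 0 := hΦt b₀ (mem_ball_self hε) ξ₀ β (-ζ) (by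
        rw [hΦb, hΦF b₀ (mem_ball_self hε), map_neg, eq_neg_iff_add_eq_zero, h0])
      subst hβ
      have hz : fderiv ℝ (F b₀) ξ₀ ζ = 0 := by simpa using h0
      have hζ : ζ = 0 := (hF b₀).2.2.2.1 ξ₀ (by rw [hz, map_zero])
      rw [hζ]
      rfl
    refine ⟨hinj, ?_⟩
    exact (LinearMap.injective_iff_surjective_of_finrank_eq_finrank
      (f := (fderiv ℝ Fu (b₀, ξ₀) : ℂ × ℂ →ₗ[ℝ] E4)) Continuity.finrank_prod_complex_eq).mp hinj
  -- (F2a) `Fu` is a local homeomorphism (inverse function theorem)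
  have hloc : IsLocalHomeomorph Fu := by
    refine IsLocalHomeomorph.mk Fu fun p => ?_
    obtain ⟨hi, hs⟩ := hF3 p
    set L : (ℂ × ℂ) ≃L[ℝ] E4 := ContinuousLinearEquiv.ofBijective (fderiv ℝ Fu p)
      (LinearMap.ker_eq_bot.mpr hi) (LinearMap.range_eq_top.mpr hs) with hL
    have hstrict : HasStrictFDerivAt Fu (L : ℂ × ℂ →L[ℝ] E4) p := by
      rw [hL, ContinuousLinearEquiv.coe_ofBijective]
      exact hF1.contDiffAt.hasStrictFDerivAt (by simp)
    exact ⟨hstrict.toOpenPartialHomeomorph Fu, hstrict.mem_toOpenPartialHomeomorph_source,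
      fun x _ => rfl⟩
  -- (F2b) `Fu` is proper: points with values in a compact set are bounded
  have hprop : IsProperMap Fu := by
    rw [isProperMap_iff_isCompact_preimage]
    refine ⟨hF1.continuous, fun K hK => ?_⟩
    obtain ⟨Cx, hCx⟩ : ∃ C : ℝ, ∀ x ∈ K, ‖x‖ ≤ C := hK.isBounded.exists_norm_le
    have hb_bd : ∀ p : ℂ × ℂ, Fu p ∈ K → ‖p.1‖ ≤ max (2 * R) Cx := fun p hpK => by
      by_cases h : 2 * R ≤ ‖p.1‖
      · have hQ : Q (Fu p) = p.1 := by
          show Q (F p.1 p.2) = p.1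
          rw [hflatF _ h]
          show Q (eP p.2 + eQ p.1) = p.1
          rw [map_add, hQeP, hQeQ, zero_add]
        calc ‖p.1‖ = ‖Q (Fu p)‖ := by rw [hQ]
          _ ≤ ‖Fu p‖ := PencilDefs.norm_Q_le hPQ _
          _ ≤ Cx := hCx _ hpK
          _ ≤ max (2 * R) Cx := le_max_right _ _
      · exact (not_le.mp h).le.trans (le_max_left _ _)
    have hξ_bd : ∀ p : ℂ × ℂ, Fu p ∈ K → ‖p.2‖ ≤ max (6 * R) (Cx + 20 * R) := fun p hpK => by
      by_cases h : 2 * R ≤ ‖p.1‖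
      · have hPx : P (Fu p) = p.2 := by
          show P (F p.1 p.2) = p.2
          rw [hflatF _ h]
          show P (eP p.2 + eQ p.1) = p.2
          rw [map_add, hPeP, hPeQ, add_zero]
        calc ‖p.2‖ = ‖P (Fu p)‖ := by rw [hPx]
          _ ≤ ‖Fu p‖ := PencilDefs.norm_P_le hPQ _
          _ ≤ Cx := hCx _ hpK
          _ ≤ Cx + 20 * R := by linarith
          _ ≤ max (6 * R) (Cx + 20 * R) := le_max_right _ _
      · push Not at h
        by_cases h6 : 6 * R ≤ ‖p.2‖
        · have hest := (helper_memberEstimates J R P Q eP eQ hR hPQ hJP hJQ (hF p.1) h).2.2.2.1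
            p.2 h6
          have hpos : 0 < ‖p.2‖ := by linarith
          have h120 : 120 * R ^ 2 / ‖p.2‖ ≤ 20 * R := by
            rw [div_le_iff₀ hpos]; nlinarith
          have htri : ‖p.2‖ ≤ ‖P (F p.1 p.2)‖ + ‖P (F p.1 p.2) - p.2‖ := by
            have := norm_sub_le (P (F p.1 p.2)) (P (F p.1 p.2) - p.2)
            rwa [sub_sub_cancel] at this
          calc ‖p.2‖ ≤ ‖P (F p.1 p.2)‖ + ‖P (F p.1 p.2) - p.2‖ := htri
            _ ≤ ‖Fu p‖ + 20 * R :=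
                add_le_add (PencilDefs.norm_P_le hPQ _) (hest.trans h120)
            _ ≤ Cx + 20 * R := by linarith [hCx _ hpK]
            _ ≤ max (6 * R) (Cx + 20 * R) := le_max_right _ _
        · exact (not_le.mp h6).le.trans (le_max_left _ _)
    exact ((isCompact_closedBall (0 : ℂ) (max (2 * R) Cx)).prod
      (isCompact_closedBall (0 : ℂ) (max (6 * R) (Cx + 20 * R)))).of_isClosed_subset
      (hK.isClosed.preimage hF1.continuous) fun p hp =>
        ⟨mem_closedBall_zero_iff.mpr (hb_bd p hp), mem_closedBall_zero_iff.mpr (hξ_bd p hp)⟩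
  -- (F2c) one good fibre: over the far point `Fu (3R, 0)` only the flat member `F (3R)` passes
  have h3R : ‖((3 * R : ℝ) : ℂ)‖ = 3 * R := by
    rw [Complex.norm_real, Real.norm_of_nonneg (by positivity)]
  have hF3R : F ((3 * R : ℝ) : ℂ) = fun ξ => eP ξ + eQ ((3 * R : ℝ) : ℂ) :=
    hflatF _ (by rw [h3R]; linarith)
  have hgood : ∃! p : ℂ × ℂ, Fu p = Fu (((3 * R : ℝ) : ℂ), 0) := by
    refine ⟨(((3 * R : ℝ) : ℂ), 0), rfl, ?_⟩
    rintro ⟨b, ξ⟩ hbξ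
    have hbξ' : F b ξ = eP 0 + eQ ((3 * R : ℝ) : ℂ) := by
      have h0 : Fu (((3 * R : ℝ) : ℂ), 0) = eP 0 + eQ ((3 * R : ℝ) : ℂ) := by
        show F ((3 * R : ℝ) : ℂ) 0 = _
        rw [hF3R]
      rw [← h0]
      exact hbξ
    have hQb : Q (F b ξ) = ((3 * R : ℝ) : ℂ) := by rw [hbξ', map_add, hQeP, hQeQ, zero_add]
    have hPb : P (F b ξ) = 0 := by rw [hbξ', map_add, hPeP, hPeQ, add_zero]
    -- a non-honest member is `Q`-confined to `|Q| ≤ 2R` (maximum principle): so `b` is far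
    have hb2 : 2 * R ≤ ‖b‖ := by
      by_contra hb
      push Not at hb
      have hconf := stub_confineQ J R hR Q (PencilDefs.norm_Q_le hPQ) hJQ (F b) (hF b).1
        (hF b).2.1 b hb (hF b).2.2.2.2.1 ξ
      rw [hQb, h3R] at hconf
      linarith
    -- and far members are the flat planes
    have hflb := hflatF b hb2
    have hQb' : Q (F b ξ) = b := by
      rw [hflb]
      show Q (eP ξ + eQ b) = b
      rw [map_add, hQeP, hQeQ, zero_add]
    have hPb' : P (F b ξ) = ξ := by
      rw [hflb]
      show P (eP ξ + eQ b) = ξ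
      rw [map_add, hPeP, hPeQ, add_zero]
    rw [Prod.mk.injEq]
    exact ⟨hQb'.symm.trans hQb, hPb'.symm.trans hPb⟩
  -- (F2) bijective: a proper local homeomorphism with one singleton fibre
  obtain ⟨hFinj, hFsurj⟩ :=
    Literature.Topology.IsLocalHomeomorph.bijective_of_existsUnique hloc hprop ⟨_, hgood⟩
  refine ⟨F, hF1, ⟨hFinj, hFsurj⟩, hF3, hF, fun b hb ξ => ?_, fun x hx => ?_⟩
  · -- (F5) honest far members
    rw [hflatF b (by linarith)]
    show Q (eP ξ + eQ b) = b
    rw [map_add, hQeP, hQeQ, zero_add]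
  · -- (F5') onto the far planes
    refine ⟨P x, ?_⟩
    rw [hflatF (Q x) (by linarith)]
    show eP (P x) + eQ (Q x) = x
    exact hsum x

end Summit.SmoothPoincare4.SmoothPoincare4.Cruxes.TameOrBrodyR4.Sketch
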